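import Mathlib
import Literature.Probability.Process.PointStationaryLaw
import Literature.Probability.Process.RootedHardCoreConfig
import Summits.AtomisticToContinuum.Crystallization.Theorems.PricedLinkCensusStackingHingeAllPointsOfRoot

/-!
# Symmetry orbits and rooted isometry classes of a point set

Auxiliary file 1 for stub `stub_finiteOrbitsOfCharged` of line `purity_stacking` of crux
`IsometryAtoms.MinimisingLawsCohesive` (stmt-AtomisticToContinuum-15777): the ALGEBRA of the rooted
isometry classes of a point set `Y` of a finite-dimensional real normed space `E` (used at `E = ℝ³`).
No new definitions are introduced; the three recurring sets are written out:

* the ORBIT of `a` under the symmetry group `{g : E ≃ᵢ E | g '' Y = Y}` of `Y`: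
  `{t | ∃ g : E ≃ᵢ E, g '' Y = Y ∧ g a = t}` — orbits of points of `Y` lie in `Y` and partition it;
* the ROOTED ISOMETRY CLASS of `Y` rooted at `q` (the event of crux `MinimisingLawsHaveAtoms` at a
  fixed root): `{μ | ∃ A : E →ₗᵢ[ℝ] E, μ = count|((fun s => A (s - q)) '' Y)}`;
* the ORBIT CLASS of `b`: copies rooted at a point of the orbit of `b`,
  `{ν | ∃ q ∈ orbit b, ν ∈ class q}`.

KEY ALGEBRA (`finiteOrbits_mem_orbit_of_mem_cls`): two rooted copies `count|A(Y - q) = count|A'(Y - q')`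
coincide only if `q' ∈ orbit q` (`x ↦ A'⁻¹(A(x - q)) + q'` is a symmetry of `Y`), so orbit classes are
equal or disjoint according as the roots are in one orbit or not; re-rooting a copy at its atom
`A(y' - q)` gives the copy rooted at `y'`; hence the atoms `y` of `ν = count|A(Y - q)` with
`θ_y ν ∈ orbit class of b` and `‖y‖ ≤ r` are the images of `orbit b ∩ B̄(q, r)`
(`atoms_inter_eq_image`), a finite set whose size only depends on the orbit of `q`.
-/

noncomputable section

open MeasureTheory Set Metric
open scoped ENNReal

namespace Summit.AtomisticToContinuum.Crystallization.Theorems.IsometryAtomsMinimisingLawsCohesive.FiniteOrbitsOfCharged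

open Literature.Probability.Process (map_sub_count_restrict count_restrict_singleton_ne_zero_iff)
open Summit.AtomisticToContinuum.Crystallization.Theorems.PricedHcpWindowsAllPointsOfRoot (eq_of_count_restrict_eq)

/-! ## Symmetries of a point set and orbits -/

section Orbit

variable {E : Type*} [NormedAddCommGroup E]

/-- Symmetries are closed under composition. -/
theorem mul_image_eq {Y : Set E} {g h : E ≃ᵢ E} (hg : g '' Y = Y) (hh : h '' Y = Y) :
    (g * h) '' Y = Y := by
  rw [IsometryEquiv.coe_mul, Set.image_comp, hh, hg]

/-- Symmetries are closed under inversion. -/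
theorem symm_image_eq {Y : Set E} {g : E ≃ᵢ E} (hg : g '' Y = Y) : g.symm '' Y = Y := by
  conv_lhs => rw [← hg]
  rw [Set.image_image]
  simp

/-- A symmetry maps points of `Y` to points of `Y`. -/
theorem apply_mem {Y : Set E} {g : E ≃ᵢ E} (hg : g '' Y = Y) {x : E} (hx : x ∈ Y) : g x ∈ Y := by
  rw [← hg]
  exact mem_image_of_mem _ hx

/-- Every point is in its own orbit. -/
theorem mem_orbit_self (Y : Set E) (a : E) : a ∈ {t | ∃ g : E ≃ᵢ E, g '' Y = Y ∧ g a = t} :=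
  ⟨1, by rw [IsometryEquiv.coe_one, Set.image_id], rfl⟩

/-- Orbits of points of `Y` lie in `Y`. -/
theorem orbit_subset {Y : Set E} {a : E} (ha : a ∈ Y) : {t | ∃ g : E ≃ᵢ E, g '' Y = Y ∧ g a = t} ⊆ Y := by
  rintro _ ⟨g, hg, rfl⟩
  exact apply_mem hg ha

/-- The orbit relation is symmetric. -/
theorem mem_orbit_symm {Y : Set E} {a t : E} (h : t ∈ {t | ∃ g : E ≃ᵢ E, g '' Y = Y ∧ g a = t}) :
    a ∈ {u | ∃ g : E ≃ᵢ E, g '' Y = Y ∧ g t = u} := by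
  obtain ⟨g, hg, rfl⟩ := h
  exact ⟨g.symm, symm_image_eq hg, by simp⟩

/-- The orbit relation is transitive. -/
theorem mem_orbit_trans {Y : Set E} {a t u : E} (h : t ∈ {t | ∃ g : E ≃ᵢ E, g '' Y = Y ∧ g a = t})
    (h' : u ∈ {u | ∃ g : E ≃ᵢ E, g '' Y = Y ∧ g t = u}) : u ∈ {u | ∃ g : E ≃ᵢ E, g '' Y = Y ∧ g a = u} := by
  obtain ⟨g, hg, rfl⟩ := h
  obtain ⟨g', hg', rfl⟩ := h'
  exact ⟨g' * g, mul_image_eq hg' hg, rfl⟩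

/-- Points in the same orbit have the same orbit. -/
theorem orbit_eq_of_mem {Y : Set E} {a t : E} (h : t ∈ {t | ∃ g : E ≃ᵢ E, g '' Y = Y ∧ g a = t}) :
    {u | ∃ g : E ≃ᵢ E, g '' Y = Y ∧ g t = u} = {u | ∃ g : E ≃ᵢ E, g '' Y = Y ∧ g a = u} :=
  Set.ext fun _ => ⟨fun hu => mem_orbit_trans h hu, fun hu => mem_orbit_trans (mem_orbit_symm h) hu⟩

/-- A symmetry maps an orbit into itself. -/
theorem apply_mem_orbit {Y : Set E} {g : E ≃ᵢ E} (hg : g '' Y = Y) {b t : E}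
    (ht : t ∈ {t | ∃ g : E ≃ᵢ E, g '' Y = Y ∧ g b = t}) : g t ∈ {t | ∃ g : E ≃ᵢ E, g '' Y = Y ∧ g b = t} :=
  mem_orbit_trans ht ⟨g, hg, rfl⟩

/-- **Transport of orbit counts**: a symmetry `g` with `g a = q` maps `orbit b ∩ B̄(a, r)` onto
`orbit b ∩ B̄(q, r)`, so the number of points of the orbit of `b` within `r` of `q` only depends on
the orbit of `q`. -/
theorem ncard_orbit_inter_closedBall_eq {Y : Set E} {a q : E}
    (hq : q ∈ {t | ∃ g : E ≃ᵢ E, g '' Y = Y ∧ g a = t}) (b : E) (r : ℝ) :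
    ({t | ∃ g : E ≃ᵢ E, g '' Y = Y ∧ g b = t} ∩ closedBall q r).ncard =
      ({t | ∃ g : E ≃ᵢ E, g '' Y = Y ∧ g b = t} ∩ closedBall a r).ncard := by
  obtain ⟨g, hg, rfl⟩ := hq
  have himage : g '' ({t | ∃ g : E ≃ᵢ E, g '' Y = Y ∧ g b = t} ∩ closedBall a r) =
      {t | ∃ g : E ≃ᵢ E, g '' Y = Y ∧ g b = t} ∩ closedBall (g a) r := by
    ext t
    simp only [mem_image, mem_inter_iff, mem_closedBall]
    constructor
    · rintro ⟨u, ⟨hu, hur⟩, rfl⟩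
      exact ⟨apply_mem_orbit hg hu, by rwa [IsometryEquiv.dist_eq]⟩
    · rintro ⟨ht, htr⟩
      refine ⟨g.symm t, ⟨apply_mem_orbit (symm_image_eq hg) ht, ?_⟩, by simp⟩
      rw [← g.dist_eq, IsometryEquiv.apply_symm_apply]
      exact htr
  rw [← himage, Set.ncard_image_of_injective _ g.injective]

/-- In a `δ`-separated `Y` (`δ > 0`) of a proper space, an orbit meets every closed ball in a finite
set. -/
theorem finite_orbit_inter_closedBall [ProperSpace E] {Y : Set E} {δ : ℝ} (hδ : 0 < δ)
    (hY : ∀ x ∈ Y, ∀ y ∈ Y, x ≠ y → δ ≤ dist x y) {b : E} (hb : b ∈ Y) (q : E) (r : ℝ) :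
    ({t | ∃ g : E ≃ᵢ E, g '' Y = Y ∧ g b = t} ∩ closedBall q r).Finite :=
  (Literature.Probability.Process.LocalConfig.finite_inter_of_separated hδ hY
    (isCompact_closedBall q r)).subset fun _ ht => ⟨ht.2, orbit_subset hb ht.1⟩

end Orbit

/-! ## Rooted isometry classes: the key algebra -/

section Cls

variable {E : Type*} [NormedAddCommGroup E] [MeasurableSpace E] [MeasurableSingletonClass E]
  [NormedSpace ℝ E] [FiniteDimensional ℝ E]

/-- **Key algebra**: two rooted copies of `Y` coincide only if their roots are in the same orbit —
if `count|A(Y - q) = count|A'(Y - q')` then `x ↦ A'⁻¹(A(x - q)) + q'` is a symmetry of `Y` sending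
`q` to `q'`. -/
theorem mem_orbit_of_mem_cls {Y : Set E} {q q' : E} {ν : Measure E}
    (h : ν ∈ {μ | ∃ A : E →ₗᵢ[ℝ] E, μ = (Measure.count : Measure E).restrict ((fun s => A (s - q)) '' Y)})
    (h' : ν ∈ {μ | ∃ A : E →ₗᵢ[ℝ] E, μ = (Measure.count : Measure E).restrict ((fun s => A (s - q')) '' Y)}) :
    q' ∈ {t | ∃ g : E ≃ᵢ E, g '' Y = Y ∧ g q = t} := by
  obtain ⟨A, rfl⟩ := h
  obtain ⟨A', hA'⟩ := h'
  have hset := eq_of_count_restrict_eq hA'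
  set eA : E ≃ₗᵢ[ℝ] E := A.toLinearIsometryEquiv rfl with heA
  set eA' : E ≃ₗᵢ[ℝ] E := A'.toLinearIsometryEquiv rfl with heA'
  let g : E ≃ᵢ E :=
    ((IsometryEquiv.subRight q).trans (eA.trans eA'.symm).toIsometryEquiv).trans (IsometryEquiv.addRight q')
  have hg : ∀ x, g x = eA'.symm (A (x - q)) + q' := fun x => rfl
  refine ⟨g, ?_, by rw [hg, sub_self, map_zero, map_zero, zero_add]⟩
  ext z
  constructor
  · rintro ⟨x, hx, rfl⟩
    rw [hg]
    have hmem : A (x - q) ∈ (fun s => A' (s - q')) '' Y := hset ▸ mem_image_of_mem (fun s => A (s - q)) hx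
    simp only [Set.mem_image] at hmem
    obtain ⟨s, hs, hsx⟩ := hmem
    rw [← hsx, show A' (s - q') = eA' (s - q') from rfl, LinearIsometryEquiv.symm_apply_apply,
      sub_add_cancel]
    exact hs
  · intro hz
    have hmem : A' (z - q') ∈ (fun s => A (s - q)) '' Y :=
      hset.symm ▸ mem_image_of_mem (fun s => A' (s - q')) hz
    simp only [Set.mem_image] at hmem
    obtain ⟨x, hx, hxz⟩ := hmem
    refine ⟨x, hx, ?_⟩
    rw [hg, hxz, show A' (z - q') = eA' (z - q') from rfl, LinearIsometryEquiv.symm_apply_apply,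
      sub_add_cancel]

/-- For a copy rooted at `q`, membership in the orbit class of `b` is membership of `q` in the
orbit of `b`. -/
theorem mem_klass_iff_of_mem_cls {Y : Set E} {q b : E} {ν : Measure E}
    (h : ν ∈ {μ | ∃ A : E →ₗᵢ[ℝ] E, μ = (Measure.count : Measure E).restrict ((fun s => A (s - q)) '' Y)}) :
    ν ∈ {ν | ∃ p ∈ {t | ∃ g : E ≃ᵢ E, g '' Y = Y ∧ g b = t}, ν ∈ {μ | ∃ A : E →ₗᵢ[ℝ] E,
        μ = (Measure.count : Measure E).restrict ((fun s => A (s - p)) '' Y)}} ↔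
      q ∈ {t | ∃ g : E ≃ᵢ E, g '' Y = Y ∧ g b = t} := by
  constructor
  · rintro ⟨p, hp, h'⟩
    exact mem_orbit_trans hp (mem_orbit_of_mem_cls h' h)
  · intro hq
    exact ⟨q, hq, h⟩

omit [MeasurableSingletonClass E] [FiniteDimensional ℝ E] in
/-- Orbit classes of points in the same orbit are equal. -/
theorem klass_eq_of_mem_orbit {Y : Set E} {a b : E} (h : b ∈ {t | ∃ g : E ≃ᵢ E, g '' Y = Y ∧ g a = t}) :
    {ν : Measure E | ∃ p ∈ {t | ∃ g : E ≃ᵢ E, g '' Y = Y ∧ g b = t}, ν ∈ {μ | ∃ A : E →ₗᵢ[ℝ] E,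
        μ = (Measure.count : Measure E).restrict ((fun s => A (s - p)) '' Y)}} =
      {ν : Measure E | ∃ p ∈ {t | ∃ g : E ≃ᵢ E, g '' Y = Y ∧ g a = t}, ν ∈ {μ | ∃ A : E →ₗᵢ[ℝ] E,
        μ = (Measure.count : Measure E).restrict ((fun s => A (s - p)) '' Y)}} := by
  ext ν
  simp only [mem_setOf_eq, orbit_eq_of_mem h]

/-- Orbit classes of points in different orbits are disjoint. -/
theorem disjoint_klass {Y : Set E} {a b : E} (h : b ∉ {t | ∃ g : E ≃ᵢ E, g '' Y = Y ∧ g a = t}) :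
    Disjoint
      {ν : Measure E | ∃ p ∈ {t | ∃ g : E ≃ᵢ E, g '' Y = Y ∧ g a = t}, ν ∈ {μ | ∃ A : E →ₗᵢ[ℝ] E,
        μ = (Measure.count : Measure E).restrict ((fun s => A (s - p)) '' Y)}}
      {ν : Measure E | ∃ p ∈ {t | ∃ g : E ≃ᵢ E, g '' Y = Y ∧ g b = t}, ν ∈ {μ | ∃ A : E →ₗᵢ[ℝ] E,
        μ = (Measure.count : Measure E).restrict ((fun s => A (s - p)) '' Y)}} := by
  refine Set.disjoint_left.2 fun ν ⟨q, hq, hν⟩ ⟨q', hq', hν'⟩ => h ?_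
  exact mem_orbit_trans (mem_orbit_trans hq (mem_orbit_of_mem_cls hν hν')) (mem_orbit_symm hq')

end Cls

/-! ## Re-rooting a copy at one of its atoms, and the atoms sent to an orbit class -/

section Reroot

variable {E : Type*} [NormedAddCommGroup E] [MeasurableSpace E] [BorelSpace E]

/-- **Re-rooting**: the copy `count|A(Y - q)` re-rooted at its atom `A(y' - q)` is the copy
`count|A(Y - y')`. -/
theorem map_sub_count_restrict_image [NormedSpace ℝ E] (Y : Set E) (A : E →ₗᵢ[ℝ] E) (q y' : E) :
    ((Measure.count : Measure E).restrict ((fun s => A (s - q)) '' Y)).map (fun z => z - A (y' - q)) =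
      (Measure.count : Measure E).restrict ((fun s => A (s - y')) '' Y) := by
  rw [map_sub_count_restrict, Set.image_image]
  congr 1
  refine Set.image_congr fun s _ => ?_
  rw [← map_sub, sub_sub_sub_cancel_right]

variable [NormedSpace ℝ E] [FiniteDimensional ℝ E]

/-- **The atoms sent to the orbit class of `b`**: for the copy `ν = count|A(Y - q)` (`b ∈ Y`), the
atoms `y` of `ν` with `θ_y ν` in the orbit class of `b` and `‖y‖ ≤ r` are exactly the images
`A(s - q)` of the points `s` of the orbit of `b` with `dist s q ≤ r`. -/
theorem atoms_inter_eq_image {Y : Set E} {b : E} (hb : b ∈ Y) (A : E →ₗᵢ[ℝ] E) (q : E) (r : ℝ) :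
    {y | ((Measure.count : Measure E).restrict ((fun s => A (s - q)) '' Y)).map (fun z => z - y) ∈
        {ν : Measure E | ∃ p ∈ {t | ∃ g : E ≃ᵢ E, g '' Y = Y ∧ g b = t}, ν ∈ {μ | ∃ A : E →ₗᵢ[ℝ] E,
          μ = (Measure.count : Measure E).restrict ((fun s => A (s - p)) '' Y)}} ∧
        y ∈ closedBall (0 : E) r} ∩ ((fun s => A (s - q)) '' Y) =
      (fun s => A (s - q)) '' ({t | ∃ g : E ≃ᵢ E, g '' Y = Y ∧ g b = t} ∩ closedBall q r) := by
  ext y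
  simp only [mem_inter_iff, mem_setOf_eq, mem_closedBall, dist_zero_right, mem_image]
  constructor
  · rintro ⟨⟨hK, hr⟩, s, hs, rfl⟩
    refine ⟨s, ⟨?_, ?_⟩, rfl⟩
    · rw [map_sub_count_restrict_image] at hK
      exact (mem_klass_iff_of_mem_cls ⟨A, rfl⟩).1 hK
    · rwa [LinearIsometry.norm_map, ← dist_eq_norm] at hr
  · rintro ⟨s, ⟨hs, hr⟩, rfl⟩
    refine ⟨⟨?_, ?_⟩, s, orbit_subset hb hs, rfl⟩
    · rw [map_sub_count_restrict_image]
      exact (mem_klass_iff_of_mem_cls ⟨A, rfl⟩).2 hs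
    · rwa [LinearIsometry.norm_map, ← dist_eq_norm]

end Reroot

/-! ## Counting symmetries: moves, orbit points and stabilisers -/

section Counting

variable {E : Type*} [NormedAddCommGroup E]

/-- **Fibres of the orbit map are cosets of the stabiliser**: the number of symmetries moving `b`
into `B̄(a, r)` is the number of orbit points of `b` in `B̄(a, r)` times the order of the stabiliser
of `b` (as `Nat.card`s; both sides vanish when infinite). -/
theorem card_moves_eq (Y : Set E) (a b : E) (r : ℝ) :
    Nat.card {g : E ≃ᵢ E // g '' Y = Y ∧ dist (g b) a ≤ r} =
      ({t | ∃ g : E ≃ᵢ E, g '' Y = Y ∧ g b = t} ∩ closedBall a r).ncard *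
        Nat.card {g : E ≃ᵢ E // g '' Y = Y ∧ g b = b} := by
  classical
  set T : Set E := {t | ∃ g : E ≃ᵢ E, g '' Y = Y ∧ g b = t} ∩ closedBall a r with hT
  rw [← Nat.card_coe_set_eq T, ← Nat.card_prod]
  have hsec : ∀ t : T, ∃ g : E ≃ᵢ E, g '' Y = Y ∧ g b = t := fun t => t.2.1
  choose γ hγY hγb using hsec
  let φ : T × {g : E ≃ᵢ E // g '' Y = Y ∧ g b = b} → {g : E ≃ᵢ E // g '' Y = Y ∧ dist (g b) a ≤ r} :=
    fun p => ⟨γ p.1 * p.2.1, mul_image_eq (hγY p.1) p.2.2.1, by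
      rw [IsometryEquiv.mul_apply, p.2.2.2, hγb]
      exact mem_closedBall.1 p.1.2.2⟩
  have hφ : ∀ p, (φ p).1 = γ p.1 * p.2.1 := fun p => rfl
  refine (Nat.card_congr (Equiv.ofBijective φ ⟨?_, ?_⟩)).symm
  · rintro ⟨t, s⟩ ⟨t', s'⟩ h
    have h1 : γ t * s.1 = γ t' * s'.1 := by rw [← hφ (t, s), ← hφ (t', s'), h]
    have ht : t = t' := by
      apply Subtype.ext
      have h2 := congrArg (fun g : E ≃ᵢ E => g b) h1
      simp only [IsometryEquiv.mul_apply, s.2.2, s'.2.2, hγb] at h2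
      exact h2
    subst ht
    rw [Subtype.ext (mul_left_cancel h1)]
  · rintro ⟨g, hgY, hgr⟩
    have ht : g b ∈ T := ⟨⟨g, hgY, rfl⟩, mem_closedBall.2 hgr⟩
    refine ⟨(⟨g b, ht⟩, ⟨(γ ⟨g b, ht⟩).symm * g, mul_image_eq (symm_image_eq (hγY _)) hgY, ?_⟩), ?_⟩
    · rw [IsometryEquiv.mul_apply]
      apply (γ ⟨g b, ht⟩).injective
      rw [IsometryEquiv.apply_symm_apply, hγb]
    · apply Subtype.ext
      rw [hφ]
      ext x
      simp [IsometryEquiv.mul_apply]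

/-- **Inversion of moves**: `g ↦ g⁻¹` is a bijection between the symmetries moving `b` into
`B̄(a, r)` and the symmetries moving `a` into `B̄(b, r)`. -/
theorem card_moves_symm (Y : Set E) (a b : E) (r : ℝ) :
    Nat.card {g : E ≃ᵢ E // g '' Y = Y ∧ dist (g b) a ≤ r} =
      Nat.card {g : E ≃ᵢ E // g '' Y = Y ∧ dist (g a) b ≤ r} := by
  have key : ∀ (a b : E) (g : E ≃ᵢ E), dist (g b) a ≤ r → dist (g.symm a) b ≤ r := by
    intro a b g h
    rw [← g.dist_eq, IsometryEquiv.apply_symm_apply, dist_comm]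
    exact h
  exact Nat.card_congr
    { toFun := fun g => ⟨g.1.symm, symm_image_eq g.2.1, key a b g.1 g.2.2⟩
      invFun := fun g => ⟨g.1.symm, symm_image_eq g.2.1, key b a g.1 g.2.2⟩
      left_inv := fun g => Subtype.ext g.1.symm_symm
      right_inv := fun g => Subtype.ext g.1.symm_symm }

/-- The symmetries moving `b` into `B̄(a, r)` all move the point `b` of norm `≤ R` to a point of norm
`≤ R`, `R = max ‖b‖ (‖a‖ + r)`; so they are finitely many as soon as such sets are finite. -/
theorem finite_moves {Y : Set E}
    (hfin : ∀ R : ℝ, {g : E ≃ᵢ E | g '' Y = Y ∧ ∃ x : E, ‖x‖ ≤ R ∧ ‖g x‖ ≤ R}.Finite) (a b : E) (r : ℝ) :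
    {g : E ≃ᵢ E | g '' Y = Y ∧ dist (g b) a ≤ r}.Finite := by
  refine (hfin (max ‖b‖ (‖a‖ + r))).subset fun g hg => ⟨hg.1, b, le_max_left _ _, ?_⟩
  have h1 : ‖g b‖ ≤ ‖a‖ + dist (g b) a := by
    rw [dist_eq_norm]
    calc ‖g b‖ = ‖a + (g b - a)‖ := by rw [add_sub_cancel]
      _ ≤ ‖a‖ + ‖g b - a‖ := norm_add_le _ _
  exact (h1.trans (by linarith [hg.2])).trans (le_max_right _ _)

/-- The stabiliser of `b` is finite as soon as the sets of symmetries moving a point of norm `≤ R`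
to a point of norm `≤ R` are finite. -/
theorem finite_stab {Y : Set E}
    (hfin : ∀ R : ℝ, {g : E ≃ᵢ E | g '' Y = Y ∧ ∃ x : E, ‖x‖ ≤ R ∧ ‖g x‖ ≤ R}.Finite) (b : E) :
    {g : E ≃ᵢ E | g '' Y = Y ∧ g b = b}.Finite :=
  (hfin ‖b‖).subset fun g hg => ⟨hg.1, b, le_rfl, by rw [hg.2]⟩

/-- With finitely many moves, the identity is a move of `b` into `B̄(a, dist b a)`, so the number of
such moves is positive. -/
theorem card_moves_pos {Y : Set E}
    (hfin : ∀ R : ℝ, {g : E ≃ᵢ E | g '' Y = Y ∧ ∃ x : E, ‖x‖ ≤ R ∧ ‖g x‖ ≤ R}.Finite) (a b : E) :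
    0 < Nat.card {g : E ≃ᵢ E // g '' Y = Y ∧ dist (g b) a ≤ dist b a} := by
  haveI : Finite {g : E ≃ᵢ E // g '' Y = Y ∧ dist (g b) a ≤ dist b a} := (finite_moves hfin a b _).to_subtype
  haveI : Nonempty {g : E ≃ᵢ E // g '' Y = Y ∧ dist (g b) a ≤ dist b a} :=
    ⟨⟨1, by rw [IsometryEquiv.coe_one, Set.image_id], le_rfl⟩⟩
  exact Nat.card_pos

end Counting

/-! ## Anchor (registered helper statement) -/

/-- **Registered helper** `finiteOrbits_mem_orbit_of_mem_cls` (anchor of this file): in `ℝ³`, two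
rooted copies `count|A(Y - q)` and `count|A'(Y - q')` of a point set `Y` coincide only if some
isometry `g` of `ℝ³` with `g '' Y = Y` sends `q` to `q'`. -/
theorem finiteOrbits_mem_orbit_of_mem_cls : ∀ (Y : Set (EuclideanSpace ℝ (Fin 3))) (q q' : EuclideanSpace ℝ (Fin 3)) (A A' : EuclideanSpace ℝ (Fin 3) →ₗᵢ[ℝ] EuclideanSpace ℝ (Fin 3)), (MeasureTheory.Measure.count : MeasureTheory.Measure (EuclideanSpace ℝ (Fin 3))).restrict ((fun s => A (s - q)) '' Y) = (MeasureTheory.Measure.count : MeasureTheory.Measure (EuclideanSpace ℝ (Fin 3))).restrict ((fun s => A' (s - q')) '' Y) → ∃ g : EuclideanSpace ℝ (Fin 3) ≃ᵢ EuclideanSpace ℝ (Fin 3), g '' Y = Y ∧ g q = q' := by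
  intro Y q q' A A' h
  exact mem_orbit_of_mem_cls (Y := Y) (ν := (Measure.count : Measure (EuclideanSpace ℝ (Fin 3))).restrict
    ((fun s => A (s - q)) '' Y)) ⟨A, rfl⟩ ⟨A', h⟩

end Summit.AtomisticToContinuum.Crystallization.Theorems.IsometryAtomsMinimisingLawsCohesive.FiniteOrbitsOfCharged

end
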